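import Summits.NavierStokesRegularity.NavierStokesRegularity.Theorems.StrainDoorsDSSThreeNumbersHolds
import Summits.NavierStokesRegularity.NavierStokesRegularity.Theorems.StrainClockDoorsDefs
import HarnessLib

/-!
# StrainDoorsDSSPackageGeometry — floor, parabolic cone and the pressure alternative for the three numbers

nsreg-p1 g35, ROUND-56 PART E, v1.1 (R57 erratum: the prose threshold is `2√2`, not `2`; Lean unchanged) (helper lane of `stmt-NavierStokesRegularity-0056`, rung N0; lands after PART D
`StrainDoorsDSSThreeNumbersHolds`).

ROUNDS 53–55 attached to every `c`-DSS classical solution of Chae–Wolf's class (`ν = 1`, slices continuous into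
`L^q`, `q ≥ 3`) with `ω ≢ 0` three ATTAINED scale-invariant numbers — the strain number `N* = max (0−t)λ₁ ≥ 1`, the
vorticity number `W* = max (0−t)|ω|`, the velocity number `V* = max (0−t)|u|²` — and three one-sided record laws
(`chaeWolf_dss_three_numbers_holds`).  This file adds the GEOMETRY of the package, again with no hypothesis beyond
the class unless stated:

* §1 `typeI_velocity_number_floor` — a UNIVERSAL FLOOR for the velocity number: there is an absolute `ε₀ > 0`
  (the smallness constant of `ChaeWolf.exists_eps_typeI_small_eq_zero`, i.e. of the KNSS/Chae–Wolf ε-regularity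
  step) such that every nonzero classical Type-I solution on `(−∞,0) × ℝ³` — DSS or not — has a point with
  `(0−t)|u|² > ε₀²`; hence `V* > ε₀²` for every DSS candidate (`dss_velocity_record_floor_holds`).
* §2 PARABOLIC CONES: a point where `(0−t)|u|² ≥ ε²` lies in the cone `|x| ≤ (C₀/ε − 1)√(0−t)` of the Type-I
  constant (`cone_of_velocity_floor`); a point where `(0−t)|∇u| ≥ 1` lies in the cone `|x| ≤ √(C₁−1)·√(0−t)` of a
  gradient bound of Chae–Wolf's shape (3.6), `|∇u| ≤ C₁/((0−t)+|x|²)`, and forces `C₁ ≥ 1`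
  (`cone_of_gradient_floor`).  Consequently the velocity record of a DSS candidate lies in the cone of aperture
  `C₀/ε₀ − 1` (hypothesis-free), and the strain and vorticity records lie in the cone of aperture `√(C₁−1)` of any
  gradient constant `C₁`, which is therefore `≥ 1` (`dss_strain_vorticity_records_cone`): the records of a
  self-similar singularity cannot drift away from the parabolic neighbourhood of the singular point.
* §3 THE PRESSURE ALTERNATIVE at the strain record (`dss_pressure_alternative_holds`, hypothesis-free): with
  `H = ¼(|ω|² − ⟪ω,e⟫²) − ∂²p/∂e²` the strain feed and `W*` the vorticity number,
  `(0−t)²·(−∂²p/∂e²) ≥ N* + N*² − W*²/4 − (0−t)²·Δ-credit ≥ 2 − W*²/4`: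
  UNLESS THE VORTICITY NUMBER REACHES 2√2 (I.E. `W*²/4 ≥ 2`), THE PRESSURE IS STRICTLY CONCAVE ALONG THE MAXIMAL STRAIN DIRECTION AT THE
  STRAIN RECORD, by at least `(2 − W*²/4)/(0−t)²`.

hard core evaded: none claimed.  All statements are necessary conditions on a class that may be empty
(`TypeIDSSLiouville`); nothing here excludes a profile.

References: Chae–Wolf, arXiv:1610.09464, Thm 1.1 and (3.6); KNSS, Acta Math. 203 (2009) §4; the tree files
`StrainDoorsDSSThreeNumbers`, `StrainDoorsDSSThreeNumbersHolds`, `Literature…ChaeWolfRemovingDSSBounds`.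

LANDING NOTE (LEAD S-door ns-s30-p1 g5): two gate-forced edits vs p1's text 9781178b03724d3b — the bare `#harness_tags`
command (parse error before `namespace`) is dropped, and the restated `strainQuad_le_norm_fderiv'` is replaced by the
tree's `strainQuad_le_opNorm` (`StrainClockDoorsDefs`, dedup.landed); every other declaration is byte-identical.
-/

noncomputable section

open MeasureTheory Set Function Filter Metric Real InnerProductSpace
open _root_.Topology
open scoped ENNReal NNReal RealInnerProductSpace ContDiff Laplacian
open Literature.Analysis Literature.Analysis.FluidPDE
open Literature.Analysis.FluidPDE.VorticityDirectionDynamics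

namespace Summit.NavierStokesRegularity.NavierStokesRegularity.Theorems.StrainDoors

open Summit.NavierStokesRegularity.NavierStokesRegularity.Theorems.ArgmaxDoors

/-! ## §1 The universal floor of the velocity number -/

/-- From `(0 − t)·a² ≤ ε²` (with `t < 0`, `0 ≤ a`, `0 ≤ ε`) to `√(−t)·a ≤ ε`. [folklore] -/
theorem sqrt_mul_le_of_sq_le {t a ε : ℝ} (ht : t < 0) (ha : 0 ≤ a) (hε : 0 ≤ ε)
    (h : (0 - t) * a ^ 2 ≤ ε ^ 2) : Real.sqrt (-t) * a ≤ ε := by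
  have h1 : (Real.sqrt (-t) * a) ^ 2 ≤ ε ^ 2 := by
    rw [mul_pow, Real.sq_sqrt (by linarith)]; simpa only [zero_sub] using h
  have h2 := Real.sqrt_le_sqrt h1
  rwa [Real.sqrt_sq (mul_nonneg (Real.sqrt_nonneg _) ha), Real.sqrt_sq hε] at h2

/-- **Universal floor of the velocity number (Type I, DSS or not).**  There is an absolute constant `ε₀ > 0` such
that every classical solution of Navier–Stokes (`ν = 1`) on `(−∞,0) × ℝ³` with a Type-I bound
`|u| ≤ C₀/(|x| + √(−t))` which is not identically zero has a point with `(0 − t)|u(t,x)|² > ε₀²`.  Contrapositive of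
the ε-smallness step of Chae–Wolf / KNSS (`ChaeWolf.exists_eps_typeI_small_eq_zero`: `√(−t)|u| ≤ ε₀` everywhere
forces `u ≡ 0`). [new-combination] -/
theorem typeI_velocity_number_floor :
    ∃ ε₀ : ℝ, 0 < ε₀ ∧ ∀ {C₀ : ℝ} {u : ℝ → (EuclideanSpace ℝ (Fin 3)) → (EuclideanSpace ℝ (Fin 3))}
      {p : ℝ → (EuclideanSpace ℝ (Fin 3)) → ℝ},
      0 ≤ C₀ → IsClassicalNSSolutionOn (Iio 0) 1 0 u p → HasTypeIDecay C₀ u →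
      (∃ t₀ : ℝ, t₀ < 0 ∧ ∃ x₀ : EuclideanSpace ℝ (Fin 3), u t₀ x₀ ≠ 0) →
      ∃ t : ℝ, t < 0 ∧ ∃ x : EuclideanSpace ℝ (Fin 3), ε₀ ^ 2 < (0 - t) * ‖u t x‖ ^ 2 := by
  obtain ⟨ε₀, hε₀, hsmall⟩ := ChaeWolf.exists_eps_typeI_small_eq_zero
  refine ⟨ε₀, hε₀, fun {C₀ u p} hC₀ hsol hI hne => ?_⟩
  by_contra hcon
  push Not at hcon
  obtain ⟨t₀, ht₀, x₀, hx₀⟩ := hne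
  exact hx₀ (hsmall hC₀ hsol hI
    (fun t ht x => sqrt_mul_le_of_sq_le ht (norm_nonneg _) hε₀.le (hcon t ht x)) t₀ ht₀ x₀)

/-! ## §2 Parabolic cones -/

/-- **The velocity cone.**  Under the Type-I bound `|u(t,x)| ≤ C₀/(|x| + √(−t))`, a point with
`(0 − t)|u(t,x)|² ≥ ε²` (`ε > 0`) satisfies `|x| ≤ (C₀/ε − 1)·√(0 − t)`. [folklore] -/
theorem cone_of_velocity_floor {C₀ ε t : ℝ} {u : ℝ → (EuclideanSpace ℝ (Fin 3)) → (EuclideanSpace ℝ (Fin 3))}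
    (hI : HasTypeIDecay C₀ u) (hε : 0 < ε) (ht : t < 0) {x : EuclideanSpace ℝ (Fin 3)}
    (hfloor : ε ^ 2 ≤ (0 - t) * ‖u t x‖ ^ 2) : ‖x‖ ≤ (C₀ / ε - 1) * Real.sqrt (0 - t) := by
  have hr : 0 < Real.sqrt (0 - t) := Real.sqrt_pos.2 (by linarith)
  have h0t : (0 : ℝ) - t = -t := zero_sub t
  have h1 : ε ≤ Real.sqrt (0 - t) * ‖u t x‖ := by
    have hsq : ε ^ 2 ≤ (Real.sqrt (0 - t) * ‖u t x‖) ^ 2 := by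
      rwa [mul_pow, Real.sq_sqrt (by linarith)]
    have h2 := Real.sqrt_le_sqrt hsq
    rwa [Real.sqrt_sq hε.le, Real.sqrt_sq (mul_nonneg hr.le (norm_nonneg _))] at h2
  have hden : 0 < ‖x‖ + Real.sqrt (-t) := by rw [← h0t]; positivity
  have h2 : ‖u t x‖ * (‖x‖ + Real.sqrt (0 - t)) ≤ C₀ := by
    rw [h0t]; exact (le_div_iff₀ hden).1 (hI t ht x)
  have h3 : ε * (‖x‖ + Real.sqrt (0 - t)) ≤ C₀ * Real.sqrt (0 - t) := by
    calc ε * (‖x‖ + Real.sqrt (0 - t)) ≤ Real.sqrt (0 - t) * ‖u t x‖ * (‖x‖ + Real.sqrt (0 - t)) := by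
          gcongr
      _ = Real.sqrt (0 - t) * (‖u t x‖ * (‖x‖ + Real.sqrt (0 - t))) := by ring
      _ ≤ Real.sqrt (0 - t) * C₀ := by gcongr
      _ = C₀ * Real.sqrt (0 - t) := by ring
  have h4 : ‖x‖ + Real.sqrt (0 - t) ≤ C₀ * Real.sqrt (0 - t) / ε := by
    rw [le_div_iff₀ hε]; linarith
  calc ‖x‖ = (‖x‖ + Real.sqrt (0 - t)) - Real.sqrt (0 - t) := by ring
    _ ≤ C₀ * Real.sqrt (0 - t) / ε - Real.sqrt (0 - t) := by linarith
    _ = (C₀ / ε - 1) * Real.sqrt (0 - t) := by ring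

/-- **The gradient cone.**  Under a gradient bound of Chae–Wolf's shape (3.6), `|∇u(t,x)| ≤ C₁/((0−t) + |x|²)`
for `t < 0`, a point with `(0 − t)|∇u(t,x)| ≥ 1` satisfies `|x| ≤ √(C₁ − 1)·√(0 − t)`, and such a point forces
`C₁ ≥ 1`. [folklore] -/
theorem cone_of_gradient_floor {C₁ t : ℝ} {u : ℝ → (EuclideanSpace ℝ (Fin 3)) → (EuclideanSpace ℝ (Fin 3))}
    (hC : ∀ s : ℝ, s < 0 → ∀ y : EuclideanSpace ℝ (Fin 3), ‖fderiv ℝ (u s) y‖ ≤ C₁ / ((0 - s) + ‖y‖ ^ 2))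
    (ht : t < 0) {x : EuclideanSpace ℝ (Fin 3)} (hfloor : 1 ≤ (0 - t) * ‖fderiv ℝ (u t) x‖) :
    1 ≤ C₁ ∧ ‖x‖ ≤ Real.sqrt (C₁ - 1) * Real.sqrt (0 - t) := by
  have h0t : 0 < (0 : ℝ) - t := by linarith
  have hden : 0 < (0 - t) + ‖x‖ ^ 2 := by positivity
  have h1 : (0 - t) + ‖x‖ ^ 2 ≤ C₁ * (0 - t) := by
    have h := hC t ht x
    have h2 : 1 ≤ (0 - t) * (C₁ / ((0 - t) + ‖x‖ ^ 2)) := hfloor.trans (by gcongr)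
    rw [mul_div_assoc', le_div_iff₀ hden, one_mul] at h2
    linarith
  have hC1 : 1 ≤ C₁ := by
    by_contra hlt
    push Not at hlt
    nlinarith [sq_nonneg ‖x‖]
  refine ⟨hC1, ?_⟩
  have h2 : ‖x‖ ^ 2 ≤ (C₁ - 1) * (0 - t) := by nlinarith
  calc ‖x‖ = Real.sqrt (‖x‖ ^ 2) := (Real.sqrt_sq (norm_nonneg _)).symm
    _ ≤ Real.sqrt ((C₁ - 1) * (0 - t)) := Real.sqrt_le_sqrt h2
    _ = Real.sqrt (C₁ - 1) * Real.sqrt (0 - t) := Real.sqrt_mul (by linarith) _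

/-- The stretching rate along a unit vector is dominated by the operator norm: `⟪ξ, ∇u ξ⟫ ≤ ‖∇u‖` for `‖ξ‖ = 1`.
[folklore] -/
theorem inner_fderiv_le_opNorm (L : EuclideanSpace ℝ (Fin 3) →L[ℝ] EuclideanSpace ℝ (Fin 3))
    {ξ : EuclideanSpace ℝ (Fin 3)} (hξ : ‖ξ‖ = 1) : ⟪ξ, L ξ⟫ ≤ ‖L‖ := by
  calc ⟪ξ, L ξ⟫ ≤ ‖ξ‖ * ‖L ξ‖ := real_inner_le_norm _ _
    _ ≤ ‖ξ‖ * (‖L‖ * ‖ξ‖) := by gcongr; exact L.le_opNorm ξ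
    _ = ‖L‖ := by rw [hξ]; ring

/-- **The velocity record of a DSS candidate: floor and cone, hypothesis-free.**  For every `c`-DSS classical
solution of Chae–Wolf's class which is not identically zero, the velocity record `(t_v, x_v)` (ROUND 54) has
`(0 − t_v)|u|² > ε₀²` with the universal `ε₀` of `typeI_velocity_number_floor`, obeys the velocity record law, and
lies in the parabolic cone `|x_v| ≤ (C₀/ε₀ − 1)√(0 − t_v)` of every Type-I constant `C₀` of `u`. [new-combination] -/
theorem dss_velocity_record_floor_holds :
    ∃ ε₀ : ℝ, 0 < ε₀ ∧ ∀ {q : ℝ}, 3 ≤ q → ∀ {c : ℝ}, 1 < c →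
      ∀ {u : ℝ → (EuclideanSpace ℝ (Fin 3)) → (EuclideanSpace ℝ (Fin 3))} {p : ℝ → (EuclideanSpace ℝ (Fin 3)) → ℝ},
      IsClassicalNSSolutionOn (Iio 0) 1 0 u p →
      (∀ t < 0, MemLp (u t) (ENNReal.ofReal q) volume) →
      (∀ t₀ < 0, Filter.Tendsto (fun t => eLpNorm (u t - u t₀) (ENNReal.ofReal q) volume)
        (nhdsWithin t₀ (Iio 0)) (nhds 0)) →
      IsDiscretelySelfSimilar c u →
      (∃ t₀ : ℝ, t₀ < 0 ∧ ∃ x₀ : EuclideanSpace ℝ (Fin 3), u t₀ x₀ ≠ 0) →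
      ∃ t : ℝ, t < 0 ∧ ∃ x : EuclideanSpace ℝ (Fin 3), u t x ≠ 0 ∧
        (∀ s : ℝ, s < 0 → ∀ y : EuclideanSpace ℝ (Fin 3), (0 - s) * ‖u s y‖ ^ 2 ≤ (0 - t) * ‖u t x‖ ^ 2) ∧
        ‖u t x‖ * (1 + 2 * (0 - t) * frobeniusNormSq (fderiv ℝ (vorticityDirection (u t)) x)) ≤
          2 * (0 - t) * (-⟪vorticityDirection (u t) x, gradient (p t) x⟫) ∧
        ‖u t x‖ ≤ 2 * (0 - t) * ‖gradient (p t) x‖ ∧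
        ε₀ ^ 2 < (0 - t) * ‖u t x‖ ^ 2 ∧
        (∀ C₀ : ℝ, HasTypeIDecay C₀ u → ‖x‖ ≤ (C₀ / ε₀ - 1) * Real.sqrt (0 - t)) := by
  obtain ⟨ε₀, hε₀, hfloor⟩ := typeI_velocity_number_floor
  refine ⟨ε₀, hε₀, fun {q} hq {c} hc {u p} hsol hLq hcont hdss hne => ?_⟩
  obtain ⟨t, ht, x, hux, hmax, hlaw, hVP⟩ := chaeWolf_dss_velocity_record_law_holds hq hc hsol hLq hcont hdss hne
  obtain ⟨C, hC⟩ := chaeWolf2017_dss_typeI_decay_holds q hq c hc u p hsol hLq hcont hdss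
  obtain ⟨t₁, ht₁, x₁, hx₁⟩ := hfloor (HasTypeIDecay.nonneg' hC) hsol hC hne
  have hV : ε₀ ^ 2 < (0 - t) * ‖u t x‖ ^ 2 := hx₁.trans_le (hmax t₁ ht₁ x₁)
  exact ⟨t, ht, x, hux, hmax, hlaw, hVP, hV, fun C₀ hC₀ => cone_of_velocity_floor hC₀ hε₀ ht hV.le⟩

/-- **The strain and vorticity records lie in the gradient cone.**  For a `c`-DSS classical solution of
Chae–Wolf's class with `ω ≢ 0` and ANY gradient bound of the shape (3.6), `|∇u(t,x)| ≤ C₁/((0−t) + |x|²)`: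
`C₁ ≥ 1`, and the strain record `(t, x)` and the vorticity record `(t_ω, x_ω)` of the three numbers theorem satisfy
`|x| ≤ √(C₁−1)·√(0−t)`, `|x_ω| ≤ √(C₁−1)·√(0−t_ω)` (both records have `(0−s)|∇u| ≥ 1`: `N* ≥ 1`, resp. the
vorticity record law `(0−t_ω)(σ − |∇ξ|²) ≥ 1`). [new-combination] -/
theorem dss_strain_vorticity_records_cone {q : ℝ} (hq : 3 ≤ q) {c : ℝ} (hc : 1 < c)
    {u : ℝ → (EuclideanSpace ℝ (Fin 3)) → (EuclideanSpace ℝ (Fin 3))} {p : ℝ → (EuclideanSpace ℝ (Fin 3)) → ℝ}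
    (hsol : IsClassicalNSSolutionOn (Iio 0) 1 0 u p)
    (hLq : ∀ t < 0, MemLp (u t) (ENNReal.ofReal q) volume)
    (hcont : ∀ t₀ < 0, Filter.Tendsto (fun t => eLpNorm (u t - u t₀) (ENNReal.ofReal q) volume)
      (nhdsWithin t₀ (Iio 0)) (nhds 0))
    (hdss : IsDiscretelySelfSimilar c u)
    (hcurl : ∃ t₀ : ℝ, t₀ < 0 ∧ ∃ x₀ : EuclideanSpace ℝ (Fin 3), curl (u t₀) x₀ ≠ 0)
    {C₁ : ℝ} (hgrad : ∀ s : ℝ, s < 0 → ∀ y : EuclideanSpace ℝ (Fin 3),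
      ‖fderiv ℝ (u s) y‖ ≤ C₁ / ((0 - s) + ‖y‖ ^ 2)) :
    1 ≤ C₁ ∧
    (∃ t : ℝ, t < 0 ∧ ∃ x e : EuclideanSpace ℝ (Fin 3), ‖e‖ = 1 ∧
      (∀ s : ℝ, s < 0 → ∀ y e' : EuclideanSpace ℝ (Fin 3), ‖e'‖ = 1 →
        (0 - s) * strainQuad u s y e' ≤ (0 - t) * strainQuad u t x e) ∧
      1 ≤ (0 - t) * strainQuad u t x e ∧
      ‖x‖ ≤ Real.sqrt (C₁ - 1) * Real.sqrt (0 - t)) ∧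
    (∃ tω : ℝ, tω < 0 ∧ ∃ xω : EuclideanSpace ℝ (Fin 3), curl (u tω) xω ≠ 0 ∧
      (∀ s : ℝ, s < 0 → ∀ y : EuclideanSpace ℝ (Fin 3),
        (0 - s) * ‖curl (u s) y‖ ≤ (0 - tω) * ‖curl (u tω) xω‖) ∧
      1 + (0 - tω) * frobeniusNormSq (fderiv ℝ (vorticityDirection (curl (u tω))) xω) ≤
        (0 - tω) * strainQuad u tω xω (vorticityDirection (curl (u tω)) xω) ∧
      ‖xω‖ ≤ Real.sqrt (C₁ - 1) * Real.sqrt (0 - tω)) := by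
  obtain ⟨t, ht, x, e, he, hNmax, hN1, -, tω, htω, xω, hxω, hWmax, hWlaw, -, -⟩ :=
    chaeWolf_dss_three_numbers_holds hq hc hsol hLq hcont hdss hcurl
  have hNfloor : 1 ≤ (0 - t) * ‖fderiv ℝ (u t) x‖ :=
    hN1.trans (mul_le_mul_of_nonneg_left (strainQuad_le_opNorm u t x he) (by linarith))
  have hξ : ‖vorticityDirection (curl (u tω)) xω‖ = 1 := norm_vorticityDirection _ hxω
  have hWfloor : 1 ≤ (0 - tω) * ‖fderiv ℝ (u tω) xω‖ := by
    have h1 : 1 ≤ (0 - tω) * strainQuad u tω xω (vorticityDirection (curl (u tω)) xω) :=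
      le_trans (by nlinarith [frobeniusNormSq_nonneg (fderiv ℝ (vorticityDirection (curl (u tω))) xω)]) hWlaw
    exact h1.trans (mul_le_mul_of_nonneg_left (strainQuad_le_opNorm u tω xω hξ) (by linarith))
  obtain ⟨hC1, hxN⟩ := cone_of_gradient_floor hgrad ht hNfloor
  obtain ⟨-, hxW⟩ := cone_of_gradient_floor hgrad htω hWfloor
  exact ⟨hC1, ⟨t, ht, x, e, he, hNmax, hN1, hxN⟩, ⟨tω, htω, xω, hxω, hWmax, hWlaw, hxW⟩⟩

/-! ## §3 The pressure alternative at the strain record -/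

/-- The algebra of the pressure alternative: from the strain record law `N + N² − T₂·L ≤ T₂·(¼(w² − wₑ²) − P)`
with `L ≤ 0` (the Laplacian credit), the vorticity domination `T₂·w² ≤ W²` and `N ≥ 1`:
`T₂·(−P) ≥ N + N² − W²/4 − T₂·L ≥ 2 − W²/4`. [folklore] -/
theorem pressure_alternative_alg {N T₂ L w we P W : ℝ} (hT : 0 ≤ T₂)
    (hlaw : N + N ^ 2 - T₂ * L ≤ T₂ * (1 / 4 * (w ^ 2 - we ^ 2) - P)) (hL : L ≤ 0)
    (hw : T₂ * w ^ 2 ≤ W ^ 2) (hN : 1 ≤ N) :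
    N + N ^ 2 - W ^ 2 / 4 - T₂ * L ≤ T₂ * (-P) ∧ 2 - W ^ 2 / 4 ≤ T₂ * (-P) := by
  have h1 : T₂ * (1 / 4 * (w ^ 2 - we ^ 2) - P) ≤ W ^ 2 / 4 + T₂ * (-P) := by
    nlinarith [sq_nonneg we, mul_nonneg hT (sq_nonneg we)]
  have hTL : 0 ≤ -(T₂ * L) := by nlinarith
  constructor
  · linarith
  · nlinarith

/-- **The pressure alternative at the strain record (hypothesis-free on Chae–Wolf's class).**  For every `c`-DSS
classical solution of Chae–Wolf's class with `ω ≢ 0` there are a strain record `(t, x, e)` (with `N = (0−t)λ₁ ≥ 1`,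
`Δ-credit ≤ 0`) and a vorticity record `(t_ω, x_ω)` (value `W* = (0−t_ω)|ω(t_ω,x_ω)|` dominating every
`(0−s)|ω(s,y)|`) such that
`(0−t)²·(−∂²p/∂e²)(t,x) ≥ N + N² − W*²/4 − (0−t)²·strainLap ≥ 2 − W*²/4`:
unless the vorticity number reaches `2√2` (`W*²/4 ≥ 2`), the pressure is strictly concave along the maximal strain direction at the
strain record.  (Strain record law of ROUND 52/53 with the feed `H = ¼(|ω|² − ⟪ω,e⟫²) − ∂²p/∂e²`, the bound
`¼(0−t)²|ω(t,x)|² ≤ W*²/4`, and `N ≥ 1`.) [new-combination] -/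
theorem dss_pressure_alternative_holds {q : ℝ} (hq : 3 ≤ q) {c : ℝ} (hc : 1 < c)
    {u : ℝ → (EuclideanSpace ℝ (Fin 3)) → (EuclideanSpace ℝ (Fin 3))} {p : ℝ → (EuclideanSpace ℝ (Fin 3)) → ℝ}
    (hsol : IsClassicalNSSolutionOn (Iio 0) 1 0 u p)
    (hLq : ∀ t < 0, MemLp (u t) (ENNReal.ofReal q) volume)
    (hcont : ∀ t₀ < 0, Filter.Tendsto (fun t => eLpNorm (u t - u t₀) (ENNReal.ofReal q) volume)
      (nhdsWithin t₀ (Iio 0)) (nhds 0))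
    (hdss : IsDiscretelySelfSimilar c u)
    (hcurl : ∃ t₀ : ℝ, t₀ < 0 ∧ ∃ x₀ : EuclideanSpace ℝ (Fin 3), curl (u t₀) x₀ ≠ 0) :
    ∃ t : ℝ, t < 0 ∧ ∃ x e : EuclideanSpace ℝ (Fin 3), ‖e‖ = 1 ∧
      (∀ s : ℝ, s < 0 → ∀ y e' : EuclideanSpace ℝ (Fin 3), ‖e'‖ = 1 →
        (0 - s) * strainQuad u s y e' ≤ (0 - t) * strainQuad u t x e) ∧
      1 ≤ (0 - t) * strainQuad u t x e ∧ strainLap u t x e ≤ 0 ∧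
      ∃ tω : ℝ, tω < 0 ∧ ∃ xω : EuclideanSpace ℝ (Fin 3), curl (u tω) xω ≠ 0 ∧
        (∀ s : ℝ, s < 0 → ∀ y : EuclideanSpace ℝ (Fin 3),
          (0 - s) * ‖curl (u s) y‖ ≤ (0 - tω) * ‖curl (u tω) xω‖) ∧
        (0 - t) * strainQuad u t x e + ((0 - t) * strainQuad u t x e) ^ 2
            - ((0 - tω) * ‖curl (u tω) xω‖) ^ 2 / 4 - (0 - t) ^ 2 * strainLap u t x e
          ≤ (0 - t) ^ 2 * (-pressureHess p t x e) ∧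
        2 - ((0 - tω) * ‖curl (u tω) xω‖) ^ 2 / 4 ≤ (0 - t) ^ 2 * (-pressureHess p t x e) := by
  -- the vorticity record (hypothesis-free W-law) and the positivity witness it provides
  obtain ⟨tω, htω, xω, hxω, hWmax, -, hξ, hWlaw⟩ := dss_vorticity_record_law_holds hq hc hsol hLq hcont hdss hcurl
  have hqpos : 0 < strainQuad u tω xω (vorticityDirection (curl (u tω)) xω) := by
    have h1 : 1 ≤ (0 - tω) * strainQuad u tω xω (vorticityDirection (curl (u tω)) xω) :=
      le_trans (by nlinarith [frobeniusNormSq_nonneg (fderiv ℝ (vorticityDirection (curl (u tω))) xω)]) hWlaw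
    by_contra hle
    push Not at hle
    nlinarith
  -- the strain record (hypothesis-free N-law)
  obtain ⟨t, ht, x, e, he, hq0, hNmax, hlap, hNlaw, -⟩ :=
    dss_strain_record_law_holds hq hc hsol hLq hcont hdss ⟨tω, htω, xω, _, hξ, hqpos⟩
  -- N ≥ 1 : the strain record dominates the vorticity record's stretching number, which is ≥ 1
  have hN1 : 1 ≤ (0 - t) * strainQuad u t x e := by
    have h1 : 1 ≤ (0 - tω) * strainQuad u tω xω (vorticityDirection (curl (u tω)) xω) :=
      le_trans (by nlinarith [frobeniusNormSq_nonneg (fderiv ℝ (vorticityDirection (curl (u tω))) xω)]) hWlaw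
    exact h1.trans (hNmax tω htω xω _ hξ)
  -- vorticity domination at the strain record point, squared
  have hw : (0 - t) ^ 2 * ‖curl (u t) x‖ ^ 2 ≤ ((0 - tω) * ‖curl (u tω) xω‖) ^ 2 := by
    have h1 := hWmax t ht x
    have h0 : 0 ≤ (0 - t) * ‖curl (u t) x‖ := mul_nonneg (by linarith) (norm_nonneg _)
    calc (0 - t) ^ 2 * ‖curl (u t) x‖ ^ 2 = ((0 - t) * ‖curl (u t) x‖) ^ 2 := by ring
      _ ≤ ((0 - tω) * ‖curl (u tω) xω‖) ^ 2 := pow_le_pow_left₀ h0 h1 2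
  have hF : strainFeed u p t x e = 1 / 4 * (‖curl (u t) x‖ ^ 2 - ⟪curl (u t) x, e⟫ ^ 2) - pressureHess p t x e :=
    rfl
  rw [hF] at hNlaw
  obtain ⟨hA, hB⟩ := pressure_alternative_alg (sq_nonneg (0 - t)) hNlaw hlap hw hN1
  exact ⟨t, ht, x, e, he, hNmax, hN1, hlap, tω, htω, xω, hxω, hWmax, hA, hB⟩

end Summit.NavierStokesRegularity.NavierStokesRegularity.Theorems.StrainDoors

end
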